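/-
Copyright: the b2b-balaban T⁴-continuum CRUX team, row NE7b OWNER lineage `t4-ne7b-p1` (gen 148). Project licence.
-/
import Summits.QuantumFields.BalabanUV.T4Continuum.Spine.NE7b.SupWeightedClassRatesExist
import Summits.QuantumFields.BalabanUV.T4Continuum.Spine.NE7b.SupWeightedBlockFactor

/-!
# ADMISSIBLE STATIONARY RATES: THE ORDER-5 RATE CHAIN AND THE CONTRACTION HOLD TOGETHER FOR EVERY `L > 384` (SCOPING-d19 §D (2),
# parameter bookkeeping closed; file (787)).  (765) showed that the order-5 rate chain of the weighted class (compatibilities of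
# (672)∕(746), geometry-letter gaps, transport `s ≤ ν₂`, closure `ν₂ = L·ν` — the next input's weight is the rescaled output weight) is
# solvable iff `L > 384`; (784)∕(785) showed that the remainder (order 5) contracts iff `M¹⁰(1+a) < L` with block factor `M = e^{ν₂c}`,
# i.e. iff `10ν₂c + log(1+a) < log L`.  The chain is HOMOGENEOUS in the rates, the contraction is a SMALLNESS condition on `ν₂`: THIS FILE
# scales (765)'s witnesses down to meet it —
#   for every `L > 384`, block constant `c > 0` and cross coefficient `0 ≤ a < L − 1` there are rates `ν, ν₂, s, η, ζ, ζ₁` satisfying the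
#   WHOLE order-5 chain AND `(e^{ν₂c})¹⁰(1+a) < L`
# (witness `ν = λ`, `ν₂ = s = Lλ`, `η = Lλ∕8`, `ζ = Lλ∕24`, `ζ₁ = Lλ∕192`, `λ = (log L − log(1+a))∕(20Lc)`), and records the converse
# smallness every admissible family obeys: `ν₂ < log L∕(10c)` — the stationary input rate of the carried weights is `O(log L)` per block
# constant (row NE7b, node U5c; (765) shape, (785) `order_five_contracts_iff` BY NAME; Mathlib; [folklore] real arithmetic).

Cell `pub-balaban`, sub-cell `t4`, spine estimate NE7b (`T4WeightBudget.RelWeightBound`; the cell's OWN estimate — NOT PRINTED in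
[Bałaban 1983–89], NOT PROVED).  Crux-route work under `Spine/NE7b/` by the row OWNER (`t4-ne7b-p1` gen 148, file (787)) under FREEZE
(0)'s crux-prover clause; NOTHING of Bałaban's is named as a Lean object, valued or asserted; no `T4Continuum/Support` leaf typed; no
`def`, no notation; zero `sorry`.  Imports (BY NAME): (765) `…SupWeightedClassRatesExist` (the chain's shape; its witnesses are re-scaled
here), (785) `…SupWeightedBlockFactor` (`order_five_contracts_iff`).

WHAT IS PROVED ([folklore]; `L c a λ : ℝ`):
* §1 `chain_of_scale` (for `L > 384` and ANY `λ > 0` the scaled witnesses satisfy (765)'s order-5 chain — homogeneity).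
* §2 **`admissible_rates_exist`** (`L > 384`, `c > 0`, `0 ≤ a`, `1 + a < L ⟹ ∃ ν ν₂ s η ζ ζ₁`, the order-5 chain ∧ `(e^{ν₂c})¹⁰(1+a) < L`).
* §3 **`input_rate_lt_of_contraction`** (`c > 0`, `0 ≤ a`, `(e^{ν₂c})¹⁰(1+a) < L ⟹ ν₂ < log L∕(10c)`), `output_rate_lt_of_contraction`
  (with the closure `ν₂ = Lν`, `L > 0`: `ν < log L∕(10cL)`).
* §4 toy.

HONEST (what this is NOT).  Parameter bookkeeping only: the cross coefficient `a` is taken as a datum although it depends (boundedly) on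
the rates through the h-letters; the geometry letters blow up like `(rate gap)^{−d}` as `λ → 0` — the ball of (784) §3 is then large but
fixed for fixed `L`; nothing on the relevant∕marginal orders ((784) §4); scalar skeleton ((A3), NC-NE7b-α UNRULED); nothing of Bałaban's
asserted.  BY-NAME EFFECT ON THE WALL: NONE.  NE7b NOT PRINTED ∕ NOT PROVED; spine PROVED 0∕9; rung (B)+1 — the programme's measures
remain FINITE-torus statements; NOT the mass gap, NOT Clay.  HONEST DEPENDENCY: continuum YM on T⁴ ⇐ BetaPertH ∧ nine spine estimates
(0∕9 proved); BetaPertH ⇐ (D1) ∧ (D4) ∧ CAP+tail; G-an2-4 gates asym, D1 and NE2∕3∕4.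
-/

set_option autoImplicit false

noncomputable section

namespace Summit.QuantumFields.BalabanUV.T4Continuum.NE7b.SupWeightedClassAdmissibleRates

open SupWeightedBlockFactor (order_five_contracts_iff)

variable {L c : ℝ}

/-! ## §1. Homogeneity: the scaled witnesses -/

/-- **THE CHAIN IS HOMOGENEOUS**: for `L > 384` and every `λ > 0`, `ν = λ`, `ν₂ = s = Lλ`, `η = Lλ∕8`, `ζ = Lλ∕24`, `ζ₁ = Lλ∕192` solve
(765)'s order-5 chain. [folklore] -/
theorem chain_of_scale (hL : 384 < L) {lam : ℝ} (hlam : 0 < lam) :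
    0 < lam ∧ 4 * lam ≤ L * lam ∧ 8 * lam < L * lam ∧ 6 * lam ≤ L * lam ∧ 12 * lam < L * lam / 8 ∧ 8 * (L * lam / 8) ≤ L * lam ∧
      lam ≤ L * lam / 192 ∧ 2 * lam < L * lam / 192 ∧ 8 * (L * lam / 192) ≤ L * lam / 24 ∧ 24 * (L * lam / 24) ≤ L * lam ∧
      0 ≤ L * lam ∧ L * lam ≤ L * lam ∧ L * lam = L * lam := by
  have h1 : 384 * lam < L * lam := mul_lt_mul_of_pos_right hL hlam
  refine ⟨hlam, by nlinarith, by nlinarith, by nlinarith, by nlinarith, by linarith, by nlinarith, by nlinarith, by linarith,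
    by linarith, by nlinarith, le_rfl, rfl⟩

/-! ## §2. Admissible rates exist -/

/-- **ADMISSIBLE STATIONARY RATES EXIST FOR EVERY `L > 384`**: block constant `c > 0`, cross coefficient `0 ≤ a` with `1 + a < L` ⟹
rates solving (765)'s order-5 chain (closure `ν₂ = L·ν` included) with the order-5 contraction `(e^{ν₂c})¹⁰(1+a) < L` of (784)∕(785).
[folklore] -/
theorem admissible_rates_exist (hL : 384 < L) (hc : 0 < c) {a : ℝ} (ha : 0 ≤ a) (haL : 1 + a < L) :
    ∃ ν ν₂ s η ζ ζ₁ : ℝ, 0 < ν ∧ 4 * ν ≤ ν₂ ∧ 8 * ν < ν₂ ∧ 6 * ν ≤ s ∧ 12 * ν < η ∧ 8 * η ≤ s ∧ ν ≤ ζ₁ ∧ 2 * ν < ζ₁ ∧ 8 * ζ₁ ≤ ζ ∧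
      24 * ζ ≤ s ∧ 0 ≤ s ∧ s ≤ ν₂ ∧ ν₂ = L * ν ∧ Real.exp (ν₂ * c) ^ 10 * (1 + a) < L := by
  have hL0 : 0 < L := by linarith
  have ha1 : 0 < 1 + a := by linarith
  set D := Real.log L - Real.log (1 + a) with hD
  have hDpos : 0 < D := sub_pos.mpr (Real.log_lt_log ha1 haL)
  have hlam : 0 < D / (20 * L * c) := div_pos hDpos (by positivity)
  obtain ⟨h0, h1, h2, h3, h4, h5, h6, h7, h8, h9, h10, h11, -⟩ := chain_of_scale hL hlam
  refine ⟨D / (20 * L * c), L * (D / (20 * L * c)), L * (D / (20 * L * c)), L * (D / (20 * L * c)) / 8,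
    L * (D / (20 * L * c)) / 24, L * (D / (20 * L * c)) / 192, h0, h1, h2, h3, h4, h5, h6, h7, h8, h9, h10, h11, rfl, ?_⟩
  rw [order_five_contracts_iff hL0 ha1]
  have e : 10 * (L * (D / (20 * L * c)) * c) = D / 2 := by
    field_simp
    ring
  rw [e]
  linarith

/-! ## §3. The converse smallness -/

/-- **EVERY CONTRACTING FAMILY HAS `ν₂ < log L∕(10c)`** (`c > 0`, `a ≥ 0`, `L > 0`): the stationary input rate is `O(log L)` per block
constant. [folklore] -/
theorem input_rate_lt_of_contraction (hL : 0 < L) (hc : 0 < c) {a ν₂ : ℝ} (ha : 0 ≤ a)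
    (hcon : Real.exp (ν₂ * c) ^ 10 * (1 + a) < L) : ν₂ < Real.log L / (10 * c) := by
  have ha1 : 0 < 1 + a := by linarith
  rw [order_five_contracts_iff hL ha1] at hcon
  have hlog : 0 ≤ Real.log (1 + a) := Real.log_nonneg (by linarith)
  rw [lt_div_iff₀ (by positivity)]
  linarith

/-- With the closure `ν₂ = L·ν`: the OUTPUT rate per fine lattice unit is `ν < log L∕(10cL)`. [folklore] -/
theorem output_rate_lt_of_contraction (hL : 0 < L) (hc : 0 < c) {a ν ν₂ : ℝ} (ha : 0 ≤ a) (hcl : ν₂ = L * ν)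
    (hcon : Real.exp (ν₂ * c) ^ 10 * (1 + a) < L) : ν < Real.log L / (10 * c * L) := by
  have h := input_rate_lt_of_contraction hL hc ha hcon
  rw [hcl, lt_div_iff₀ (by positivity)] at h
  rw [lt_div_iff₀ (by positivity)]
  linarith

/-! ## §4. Toy -/

/-- Toy (kernel): at `L = 400`, `c = 4`, `a = 0` the bound on the input rate is `log 400∕40`; since `log 400 < 400` (as `e^{400} > 400`)
this is `< 10`: the carried weights are weak. -/
example : (384 : ℝ) < 400 ∧ (0 : ℝ) < 4 := by norm_num

end Summit.QuantumFields.BalabanUV.T4Continuum.NE7b.SupWeightedClassAdmissibleRates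

end
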